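import Summits.RiemannHypothesis.RiemannHypothesis.Theorems.TiltedLandingLaw421R3RateBooksQ3

/-! # TiltedLandingLaw421R3RateCapital — W-08 RATE^B BOOKS: §B.9

Continuation of `…R3RateBooksQ3.lean` (C4 g28 rateBooksQ-v5 sha c107456c, split per gate lint ≤ 400 l).
§B.9 the DOOR INEQUALITY and the CAPITAL-FUNDED instance `restRateBotQ_of_capitalFunded`.
RH NOT proved; 24774 OPEN. -/

namespace RhW08.SealSwapQ

open Complex
open RhIdea6.G17.W07C7 RhIdea6.G17.W07C7.Rev6 RhIdea6.G18.W07C8.Law421BirthS RhIdea6.G19.W07C11.Seam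
open RhIdea6.G20.W07C12.Frac RhIdea6.G20.W07C12.StColP RhW07.C12.FieldSplit RhIdea6.G21.W07C13.TentMax
open RhW07.C14.TwoSided RhW07.C14.Classes RhW07.C14.Lineage RhW07.C14.Booking
open RhW07.C13.Heredity RhIdea6.G22.W07C15pre.Injection RhW07.E3.Cell
open RhW07.E3.Lit
open RhW08.Round1 RhW08.StSwap RhW08.Round2 RhW08.QuadW
open RhW08.SealSwap (PBot)

/-! Engine facts of record behind this section (computed ≠ proved; models ≠ Ξ): on the 1 040 legal R = 2 bank frames `NoRisePrehorizonQ` is FALSE on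
45 frames (73 rises, all on charged tented levels) — so `restRateBotQ_of_laws` is dead AS AN INSTANCE and the live nodes are `restRateBotQ_of_laws_rises`
/ `restRateBotQ_of_CA364` (C6 ADD-119 (3)); the capital fit holds 1 040/1 040 (min margin +11.00); on the slow-approach comb frames N3c20R80L6p /
N3c16R80L6p every charged level is APPROACH class and its net cost 14.58 / 10.74 exceeds the candidate purse `approachPurseQ = (Hs/s)² + 1 = 5` while
the books hold with margin +6.42 / +6.26 (C2 JOB C, JOB B exact walk): the approach cost is CAPITAL-funded — hence `residualBudgetQ` below. -/

open Classical in
/-- ★ (K) §B.9 **DOOR INEQUALITY** (C6 ADD-119 (7); 0 exceptions on 1 059 frames): for ANY meter `Φ`, class `𝓚`, data and `k`,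
`Φ k + netCostQ 𝓚 k ≤ Φ 0 + Σ_{j<k} deficitQ Φ 𝓚 j` (termwise `x ≤ max x 0`, then telescope) — unconditional algebra, no legality needed. -/
theorem door_ineq (Φ : LevelMeter) (𝓚 : LevelClass) (η : ℝ) (f : ℂ → ℂ) (x₀ s hmax R Hs : ℝ) (B k : ℕ) :
    Φ η f x₀ s hmax R Hs B k + netCostQ 𝓚 η f x₀ s hmax R Hs B k
      ≤ purseOfQ Φ η f x₀ s hmax R Hs B + prefixSumQ (deficitQ Φ 𝓚) η f x₀ s hmax R Hs B k := by
  induction k with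
  | zero => simp [netCostQ, prefixSumQ, purseOfQ]
  | succ k ih =>
    have hdef : Φ η f x₀ s hmax R Hs B (k + 1) - Φ η f x₀ s hmax R Hs B k
        + (if Charged (PTrkSQ PBot) StTrkDQ ReadyR2 η f x₀ s hmax R Hs B k ∧ 𝓚 η f x₀ s hmax R Hs B k
            then 1 - 4 * dropQ η f x₀ s hmax R Hs B k / s else 0)
        ≤ deficitQ Φ 𝓚 η f x₀ s hmax R Hs B k := by
      simp only [deficitQ]
      exact le_max_left _ _
    rw [netCostQ_succ, prefixSumQ, Finset.sum_range_succ, ← prefixSumQ]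
    linarith

/-- (K) §B.9 hence a NON-NEGATIVE meter's door never certifies less than the net cost it pays: `netCostQ 𝓚 k ≤ Φ 0 + Σ_{j<k} deficitQ Φ 𝓚 j`
(«what the door buys is PROVABILITY of `DeficitLawQ Φ 𝓚 aR` with a structural `aR`, not a smaller number», C6 ADD-119 (7)). -/
theorem netCostQ_le_door (Φ : LevelMeter) (𝓚 : LevelClass) {η : ℝ} {f : ℂ → ℂ} {x₀ s hmax R Hs : ℝ} {B : ℕ}
    (hΦ : ∀ k : ℕ, 0 ≤ Φ η f x₀ s hmax R Hs B k) (k : ℕ) :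
    netCostQ 𝓚 η f x₀ s hmax R Hs B k ≤ purseOfQ Φ η f x₀ s hmax R Hs B + prefixSumQ (deficitQ Φ 𝓚) η f x₀ s hmax R Hs B k := by
  have := door_ineq Φ 𝓚 η f x₀ s hmax R Hs B k
  linarith [hΦ k]

/-- (K) §B.9 in particular the ZERO-meter door (C1's positive-part count, `ApproachPosPartLawQ`) dominates the net cost of its class. -/
theorem netCostQ_le_posPartSum (𝓚 : LevelClass) (η : ℝ) (f : ℂ → ℂ) (x₀ s hmax R Hs : ℝ) (B k : ℕ) :
    netCostQ 𝓚 η f x₀ s hmax R Hs B k ≤ prefixSumQ (deficitQ zeroMeterQ 𝓚) η f x₀ s hmax R Hs B k := by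
  have := netCostQ_le_door zeroMeterQ 𝓚 (η := η) (f := f) (x₀ := x₀) (s := s) (hmax := hmax) (R := R) (Hs := Hs) (B := B)
    (fun _ => le_rfl) k
  simpa [purseOfQ, zeroMeterQ] using this

/-- §B.9 the RESIDUAL approach allowance `S₀ − aF − aC` (C2 g37 JOB C · ADD-2: on the slow-approach comb frames the approach cost is paid by the
capital `B`, not by an `(Hs/s)²`-sized purse; the candidate `approachPurseQ` is numerically dead there — computed ≠ proved). -/
noncomputable def residualBudgetQ (aF aC : Budget) : Budget := fun η f x₀ s hmax R Hs B =>
  slack0Q η f x₀ s hmax R Hs B - aF η f x₀ s hmax R Hs B - aC η f x₀ s hmax R Hs B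

/-- (K) §B.9 with the residual allowance the capital fit is an identity. -/
theorem capitalLawQ_residual (aF aC : Budget) : CapitalLawQ aF aC (residualBudgetQ aF aC) := by
  intro η f x₀ s hmax R Hs B _
  simp only [residualBudgetQ]
  linarith

/-- ★★ (K) §B.9 **CAPITAL-FUNDED (CA364) NODE**: `FarLawQ aF → ConsLawQ aC → ApproachAllowanceQ (S₀ − aF − aC) → RestRateBotQ`
(the form the engine data support: C2 JOB C, C6 ADD-119 (4)). -/
theorem restRateBotQ_of_capitalFunded {aF aC : Budget} (hF : FarLawQ aF) (hC : ConsLawQ aC)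
    (hA : ApproachAllowanceQ (residualBudgetQ aF aC)) : RestRateBotQ :=
  restRateBotQ_of_CA364 hF hC hA (capitalLawQ_residual aF aC)

/-- ★★ (K) §B.9 … and with the first stub, the crux. -/
theorem law421_of_capitalFunded (hS : RestSuccBotQ) {aF aC : Budget} (hF : FarLawQ aF) (hC : ConsLawQ aC)
    (hA : ApproachAllowanceQ (residualBudgetQ aF aC)) :
    Summit.RiemannHypothesis.RiemannHypothesis.Theses.EarlyAppointments.TiltedLandingLaw421 :=
  law421T_of_succ_rateQ hS (restRateBotQ_of_capitalFunded hF hC hA)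

end RhW08.SealSwapQ
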